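import Literature.Geometry.Lorentzian.MassCapacity
import Literature.Geometry.Lorentzian.MetricComparison
import Literature.Geometry.Lorentzian.MetricDetComparison
import Literature.Geometry.Lorentzian.RiemannianMeasureComparison
import Literature.Geometry.Lorentzian.PositiveMassConformal
import HarnessLib

-- literature-prover provefact seat `Bray2001_mass_ge_half_capacity`, session 9 (2026-08-15)
/-!
# The capacity `ℰ(Σ, g)` under uniformly close metrics (Bray 2001, §6: "it follows that
# `ℰ` changes as small as one likes as well")

Theorems only; a sibling of `MassCapacity.lean` (Bray, J. Differential Geom. 59 (2001), §6,
Def. 17: `ℰ(Σ, g) = inf_φ (1/2π) ∫ |∇φ|²_g dV_g`, vendored as `horizonCapacity h e U`, with the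
Dirichlet energy `dirichletEnergy h φ = ∫ |∇φ|²_h dV_h`). Bray's proof of the mass–capacity
theorems (Thms. 8–9, the named fact `Bray2001_mass_ge_half_capacity`) uses three times, without
proof, that the capacity depends continuously on the metric under *uniform pointwise* closeness:

* §6, after Def. 16: *"since such a modification* [the harmonically flat approximation of
  Lemma 1] *can be done so as to change the metric uniformly pointwise as small as one likes, it
  follows that `ℰ(ḡ)` changes as small as one likes as well"*;
* proof of Thm. 9: the smoothings `(M̃_{Σ,δ}, g̃_δ)` of the reflected manifold approach
  `(M̄_Σ, ḡ)` *"(meaning that there exists a diffeomorphism under which the metrics are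
  arbitrarily uniformly close to each other …). Then by Definition 16 it follows that `ℰ(g̃_δ)`
  is close to `ℰ(ḡ)`"*, (94);
* proof of Thm. 9, (102)–(103): `g̃_δ = u_δ⁴ ḡ_δ` with `1 ≤ u_δ(x) ≤ 1 + ε(δ)`, `ε(δ) → 0`,
  *"hence, by equation (103), we see that the same statement is true for `g̃_δ`"*.

This file proves that step for the capacity of Def. 17 on a fixed manifold: two metrics `h, h'`
on `X` with `(1 − ε) h(v,v) ≤ h'(v,v) ≤ (1 + ε) h(v,v)` pointwise (`0 ≤ ε < 1`) have

* comparable Riemannian measures, `dV_{h'} ≤ (1+ε)^{m/2} dV_h` and `dV_h ≤ (1−ε)^{−m/2} dV_{h'}`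
  (`riemannianMeasure_le_smul_of_uniformlyClose`, `…_of_uniformlyClose'`, any dimension `m`;
  from `dV_{h'} = √det(h⁻¹h') dV_h`, `RiemannianMeasureComparison.lean`, and
  `(1−ε)^m ≤ det(h⁻¹h') ≤ (1+ε)^m`, `MetricDetComparison.lean`);
* comparable energy densities, `|∇φ|²_{h'} ≤ (1−ε)⁻¹ |∇φ|²_h` and `|∇φ|²_h ≤ (1+ε) |∇φ|²_{h'}`
  (`gradNorm_sq_le_mul_of_val_le`; the inverse metrics of comparable metrics are comparable,
  `MetricComparison.lean`);
* hence comparable Dirichlet energies and capacities (the class of test functions of Def. 17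
  does not depend on the metric):
  `ℰ_{h'} ≤ (1+ε)^{3/2} (1−ε)⁻¹ ℰ_h` and `ℰ_h ≤ (1+ε) (1−ε)^{−3/2} ℰ_{h'}`
  (`dirichletEnergy_le_mul_of_uniformlyClose(')`, `horizonCapacity_le_mul_of_uniformlyClose(')`,
  after the general forms `dirichletEnergy_le_mul_of_val_le`, `horizonCapacity_le_mul_of_val_le`
  with hypotheses `h ≤ Λ h'` and `dV_{h'} ≤ C dV_h`);
* **continuity**: if the metrics `h_n` are eventually uniformly `ε`-close to `h` for every
  `ε > 0`, then `∫ |∇φ|²_{h_n} dV_{h_n} → ∫ |∇φ|²_h dV_h` for every `φ` and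
  `ℰ_{h_n}(Σ) → ℰ_h(Σ)` (`tendsto_dirichletEnergy_of_uniformlyClose`,
  `tendsto_horizonCapacity_of_uniformlyClose`, and in `ℝ`: `tendsto_horizonCapacity_toReal_…`);
* the **conformal case** (103): for `g' = u⁴ h` with `1 − ε ≤ u⁴ ≤ 1 + ε` the two bounds hold
  (`horizonCapacity_conformal_le_mul`, `horizonCapacity_le_mul_conformal`), and `u_n → 1`
  uniformly on `X` gives `ℰ_{u_n⁴ h}(Σ) → ℰ_h(Σ)` (`tendsto_horizonCapacity_conformal`).

No definitions and no named facts are introduced.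

## References

* H. L. Bray, *Proof of the Riemannian Penrose inequality using the positive mass theorem*,
  J. Differential Geom. 59 (2001) 177–267 (arXiv:math/9911173): §2 Lemma 1 with (7)–(9); §6,
  Def. 16 and the paragraph following it, Def. 17, proof of Thm. 9 ((94), (102)–(103) and the
  paragraph following (104)). [BrayRPI2001]
* E. Hebey, *Nonlinear Analysis on Manifolds: Sobolev Spaces and Inequalities*, CIMS Lecture
  Notes 5 (1999), §2 (equivalent metrics have equivalent Dirichlet integrals).
-/

noncomputable section

open Bundle Set Manifold TopologicalSpace Filter MeasureTheory Measure Topology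
open scoped ContDiff Topology ENNReal Manifold Real

namespace Literature.Geometry.Lorentzian

open PseudoRiemannianMetric

/-! ### Riemannian measures of uniformly close metrics -/

section MeasureComparison

variable {H : Type*} [TopologicalSpace H] {n : ℕ∞ω} {m : ℕ}
  {I : ModelWithCorners ℝ (EuclideanSpace ℝ (Fin m)) H}
  {N : Type*} [TopologicalSpace N] [ChartedSpace H N] [IsManifold I ∞ N] [T3Space N]
  [MeasurableSpace N] [BorelSpace N] [SecondCountableTopology N]
  (h h' : ContMDiffRiemannianMetric I n (EuclideanSpace ℝ (Fin m)) (TangentSpace I : N → Type _))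

/-- **`dV_{h'} ≤ (1 + ε)^{m/2} dV_h` for uniformly close metrics.** If
`(1 − ε) h(v, v) ≤ h'(v, v) ≤ (1 + ε) h(v, v)` pointwise on the `m`-manifold `N` (`0 ≤ ε ≤ 1`),
then `dV_{h'} ≤ √((1+ε)^m) dV_h` as measures: `dV_{h'} = √det(h⁻¹ h') dV_h`
(`riemannianMeasure_eq_withDensity_sqrt_det_endo`) and `det(h⁻¹ h') ≤ (1 + ε)^m`
(`det_sharp_comp_toBilinForm_mem_Icc`). This is the measure half of Bray's "change the metric
uniformly pointwise as small as one likes ⇒ `ℰ` changes as small as one likes" (§6, after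
Def. 16). [cite: BrayRPI2001, §6 paragraph after Def. 16] -/
theorem riemannianMeasure_le_smul_of_uniformlyClose {ε : ℝ} (hε0 : 0 ≤ ε) (hε1 : ε ≤ 1)
    (hlo : ∀ (p : N) (v : TangentSpace I p),
      (1 - ε) * (ofRiemannian h).val p v v ≤ (ofRiemannian h').val p v v)
    (hhi : ∀ (p : N) (v : TangentSpace I p),
      (ofRiemannian h').val p v v ≤ (1 + ε) * (ofRiemannian h).val p v v) :
    riemannianMeasure h' ≤ ENNReal.ofReal (Real.sqrt ((1 + ε) ^ m)) • riemannianMeasure h := by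
  refine riemannianMeasure_le_smul_of_det_endo_le h' h (Real.sqrt_nonneg _) fun p ↦ ?_
  rw [Real.sq_sqrt (by positivity)]
  have hd := (det_sharp_comp_toBilinForm_mem_Icc (ofRiemannian h) p (isRiemannian_ofRiemannian h)
    (ofRiemannian h') hε1 (hlo p) (hhi p)).2
  rwa [finrank_euclideanSpace_fin] at hd

/-- **`dV_h ≤ (1 − ε)^{−m/2} dV_{h'}` for uniformly close metrics.** If
`(1 − ε) h(v, v) ≤ h'(v, v) ≤ (1 + ε) h(v, v)` pointwise on the `m`-manifold `N` (`0 ≤ ε < 1`),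
then `dV_h ≤ √(((1−ε)^m)⁻¹) dV_{h'}`: `det(h'⁻¹ h) = 1/det(h⁻¹ h')`
(`det_sharp_comp_toBilinForm_mul_swap`) and `det(h⁻¹ h') ≥ (1 − ε)^m`.
[cite: BrayRPI2001, §6 paragraph after Def. 16] -/
theorem riemannianMeasure_le_smul_of_uniformlyClose' {ε : ℝ} (hε1 : ε < 1)
    (hlo : ∀ (p : N) (v : TangentSpace I p),
      (1 - ε) * (ofRiemannian h).val p v v ≤ (ofRiemannian h').val p v v)
    (hhi : ∀ (p : N) (v : TangentSpace I p),
      (ofRiemannian h').val p v v ≤ (1 + ε) * (ofRiemannian h).val p v v) :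
    riemannianMeasure h ≤ ENNReal.ofReal (Real.sqrt (((1 - ε) ^ m)⁻¹)) • riemannianMeasure h' := by
  have hpos : 0 < (1 - ε) ^ m := pow_pos (by linarith) m
  refine riemannianMeasure_le_smul_of_det_endo_le h h' (Real.sqrt_nonneg _) fun p ↦ ?_
  rw [Real.sq_sqrt (inv_nonneg.2 hpos.le)]
  set D : ℝ := LinearMap.det ((((ofRiemannian h).sharp p).toLinearMap) ∘ₗ
    (ofRiemannian h').toBilinForm p) with hD
  set D' : ℝ := LinearMap.det ((((ofRiemannian h').sharp p).toLinearMap) ∘ₗ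
    (ofRiemannian h).toBilinForm p) with hD'
  have hlow : (1 - ε) ^ m ≤ D := by
    have hd := (det_sharp_comp_toBilinForm_mem_Icc (ofRiemannian h) p
      (isRiemannian_ofRiemannian h) (ofRiemannian h') hε1.le (hlo p) (hhi p)).1
    rwa [finrank_euclideanSpace_fin] at hd
  have hDpos : 0 < D := hpos.trans_le hlow
  have hswap : D' * D = 1 := det_sharp_comp_toBilinForm_mul_swap (ofRiemannian h) p (ofRiemannian h')
  have hD'eq : D' = D⁻¹ := eq_inv_of_mul_eq_one_left hswap
  rw [hD'eq]
  exact inv_anti₀ hpos hlow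

end MeasureComparison

/-! ### Energy densities, Dirichlet energies and capacities of comparable metrics -/

section EnergyComparison

variable {X : Type} [TopologicalSpace X] [ChartedSpace E3 X] [IsManifold (𝓡 3) ∞ X]
  (h h' : ContMDiffRiemannianMetric (𝓡 3) ∞ E3 (TangentSpace (𝓡 3) : X → Type _))

/-- **Comparable metrics have comparable energy densities**: if `h(v, v) ≤ Λ h'(v, v)` on `T_xX`
(`Λ ≥ 0`), then `|∇φ|²_{h'}(x) ≤ Λ |∇φ|²_h(x)` (the inverse metrics satisfy `h'⁻¹ ≤ Λ h⁻¹`,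
`innerDual_le_mul_innerDual_of_val_le`, applied to `dφ_x`). Hebey 1999, §2. [folklore] -/
theorem gradNorm_sq_le_mul_of_val_le {Λ : ℝ} (hΛ : 0 ≤ Λ) {x : X}
    (hcomp : ∀ v : TangentSpace (𝓡 3) x, (ofRiemannian h).val x v v ≤ Λ * (ofRiemannian h').val x v v)
    (φ : X → ℝ) : gradNorm h' φ x ^ 2 ≤ Λ * gradNorm h φ x ^ 2 := by
  simp only [gradNorm]
  rw [Real.sq_sqrt (innerDual_self_nonneg h' x _), Real.sq_sqrt (innerDual_self_nonneg h x _)]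
  exact innerDual_le_mul_innerDual_of_val_le (isRiemannian_ofRiemannian h')
    (isRiemannian_ofRiemannian h) hΛ x hcomp _

variable [T2Space X] [LocallyCompactSpace X] [MeasurableSpace X] [BorelSpace X]

/-- **Comparable metrics have comparable Dirichlet energies**: if `h(v, v) ≤ Λ h'(v, v)` pointwise
(`Λ ≥ 0`) and `dV_{h'} ≤ C dV_h` (`C ≥ 0`), then `∫ |∇φ|²_{h'} dV_{h'} ≤ C Λ ∫ |∇φ|²_h dV_h` for
every `φ : X → ℝ`. Hebey 1999, §2; the mechanism of Bray 2001, §6 ("`ℰ` changes as small as one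
likes"). [cite: BrayRPI2001, §6 paragraph after Def. 16] -/
theorem dirichletEnergy_le_mul_of_val_le {Λ C : ℝ} (hΛ : 0 ≤ Λ) (hC : 0 ≤ C)
    (hcomp : ∀ (x : X) (v : TangentSpace (𝓡 3) x),
      (ofRiemannian h).val x v v ≤ Λ * (ofRiemannian h').val x v v)
    (hμ : riemannianMeasure h' ≤ ENNReal.ofReal C • riemannianMeasure h) (φ : X → ℝ) :
    dirichletEnergy h' φ ≤ ENNReal.ofReal (C * Λ) * dirichletEnergy h φ := by
  simp only [dirichletEnergy]
  calc ∫⁻ x, ENNReal.ofReal (gradNorm h' φ x ^ 2) ∂riemannianMeasure h'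
      ≤ ∫⁻ x, ENNReal.ofReal Λ * ENNReal.ofReal (gradNorm h φ x ^ 2)
          ∂(ENNReal.ofReal C • riemannianMeasure h) := by
        refine lintegral_mono' hμ fun x ↦ ?_
        rw [← ENNReal.ofReal_mul hΛ]
        exact ENNReal.ofReal_le_ofReal (gradNorm_sq_le_mul_of_val_le h h' hΛ (hcomp x) φ)
    _ = ENNReal.ofReal C * (ENNReal.ofReal Λ *
          ∫⁻ x, ENNReal.ofReal (gradNorm h φ x ^ 2) ∂riemannianMeasure h) := by
        rw [lintegral_smul_measure, lintegral_const_mul' _ _ ENNReal.ofReal_ne_top, smul_eq_mul]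
    _ = ENNReal.ofReal (C * Λ) * ∫⁻ x, ENNReal.ofReal (gradNorm h φ x ^ 2) ∂riemannianMeasure h := by
        rw [ENNReal.ofReal_mul hC, mul_assoc]

/-- The capacity of `h'` is at most `K` times the capacity of `h` as soon as every test function
has `h'`-energy at most `K` times its `h`-energy (`0 < K < ∞`): the class of test functions of
Def. 17 does not depend on the metric. [cite: BrayRPI2001, §6 Def. 17] -/
theorem horizonCapacity_le_mul_of_forall_dirichletEnergy_le (e : AFEnd X) (U : Opens X)
    {K : ℝ≥0∞} (hK0 : K ≠ 0) (hK : K ≠ ⊤)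
    (hE : ∀ φ : X → ℝ, IsCapacityTestFn e U φ → dirichletEnergy h' φ ≤ K * dirichletEnergy h φ) :
    horizonCapacity h' e U ≤ K * horizonCapacity h e U := by
  simp only [horizonCapacity]
  rw [ENNReal.mul_iInf_of_ne hK0 hK]
  refine le_iInf fun φ ↦ ?_
  rw [ENNReal.mul_iInf_of_ne hK0 hK]
  refine le_iInf fun hφ ↦ ?_
  calc ⨅ (ψ : X → ℝ) (_ : IsCapacityTestFn e U ψ), ENNReal.ofReal (2 * π)⁻¹ * dirichletEnergy h' ψ
      ≤ ENNReal.ofReal (2 * π)⁻¹ * dirichletEnergy h' φ := iInf₂_le φ hφ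
    _ ≤ ENNReal.ofReal (2 * π)⁻¹ * (K * dirichletEnergy h φ) := mul_le_mul_right (hE φ hφ) _
    _ = K * (ENNReal.ofReal (2 * π)⁻¹ * dirichletEnergy h φ) := by rw [mul_left_comm]

/-- **Comparable metrics have comparable capacities**: if `h(v, v) ≤ Λ h'(v, v)` pointwise and
`dV_{h'} ≤ C dV_h` (`Λ, C > 0`), then `ℰ_{h'}(Σ) ≤ C Λ ℰ_h(Σ)` for the capacity of Def. 17 of any
horizon (`horizonCapacity · e U`). Bray 2001, §6: "it follows that `ℰ` changes as small as one
likes as well". [cite: BrayRPI2001, §6 paragraph after Def. 16] -/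
theorem horizonCapacity_le_mul_of_val_le (e : AFEnd X) (U : Opens X) {Λ C : ℝ} (hΛ : 0 < Λ)
    (hC : 0 < C)
    (hcomp : ∀ (x : X) (v : TangentSpace (𝓡 3) x),
      (ofRiemannian h).val x v v ≤ Λ * (ofRiemannian h').val x v v)
    (hμ : riemannianMeasure h' ≤ ENNReal.ofReal C • riemannianMeasure h) :
    horizonCapacity h' e U ≤ ENNReal.ofReal (C * Λ) * horizonCapacity h e U :=
  horizonCapacity_le_mul_of_forall_dirichletEnergy_le h h' e U
    (ENNReal.ofReal_pos.2 (mul_pos hC hΛ)).ne' ENNReal.ofReal_ne_top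
    fun φ _ ↦ dirichletEnergy_le_mul_of_val_le h h' hΛ.le hC.le hcomp hμ φ

variable [SecondCountableTopology X]

/-- **`∫ |∇φ|²_{h'} dV_{h'} ≤ (1+ε)^{3/2} (1−ε)⁻¹ ∫ |∇φ|²_h dV_h` for uniformly close metrics**
(`(1 − ε) h ≤ h' ≤ (1 + ε) h` pointwise, `0 ≤ ε < 1`): `dV_{h'} ≤ (1+ε)^{3/2} dV_h` and
`|∇φ|²_{h'} ≤ (1−ε)⁻¹ |∇φ|²_h`. [cite: BrayRPI2001, §6 paragraph after Def. 16] -/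
theorem dirichletEnergy_le_mul_of_uniformlyClose {ε : ℝ} (hε0 : 0 ≤ ε) (hε1 : ε < 1)
    (hlo : ∀ (x : X) (v : TangentSpace (𝓡 3) x),
      (1 - ε) * (ofRiemannian h).val x v v ≤ (ofRiemannian h').val x v v)
    (hhi : ∀ (x : X) (v : TangentSpace (𝓡 3) x),
      (ofRiemannian h').val x v v ≤ (1 + ε) * (ofRiemannian h).val x v v) (φ : X → ℝ) :
    dirichletEnergy h' φ ≤
      ENNReal.ofReal (Real.sqrt ((1 + ε) ^ 3) * (1 - ε)⁻¹) * dirichletEnergy h φ := by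
  have h1ε : 0 < 1 - ε := by linarith
  refine dirichletEnergy_le_mul_of_val_le h h' (inv_nonneg.2 h1ε.le) (Real.sqrt_nonneg _)
    (fun x v ↦ ?_) (riemannianMeasure_le_smul_of_uniformlyClose h h' hε0 hε1.le hlo hhi) φ
  rw [← div_eq_inv_mul, le_div_iff₀ h1ε, mul_comm]
  exact hlo x v

/-- **`∫ |∇φ|²_h dV_h ≤ (1+ε) (1−ε)^{−3/2} ∫ |∇φ|²_{h'} dV_{h'}` for uniformly close metrics**
(`(1 − ε) h ≤ h' ≤ (1 + ε) h` pointwise, `0 ≤ ε < 1`): `dV_h ≤ (1−ε)^{−3/2} dV_{h'}` and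
`|∇φ|²_h ≤ (1+ε) |∇φ|²_{h'}`. [cite: BrayRPI2001, §6 paragraph after Def. 16] -/
theorem dirichletEnergy_le_mul_of_uniformlyClose' {ε : ℝ} (hε0 : 0 ≤ ε) (hε1 : ε < 1)
    (hlo : ∀ (x : X) (v : TangentSpace (𝓡 3) x),
      (1 - ε) * (ofRiemannian h).val x v v ≤ (ofRiemannian h').val x v v)
    (hhi : ∀ (x : X) (v : TangentSpace (𝓡 3) x),
      (ofRiemannian h').val x v v ≤ (1 + ε) * (ofRiemannian h).val x v v) (φ : X → ℝ) :
    dirichletEnergy h φ ≤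
      ENNReal.ofReal (Real.sqrt (((1 - ε) ^ 3)⁻¹) * (1 + ε)) * dirichletEnergy h' φ :=
  dirichletEnergy_le_mul_of_val_le h' h (by linarith) (Real.sqrt_nonneg _) hhi
    (riemannianMeasure_le_smul_of_uniformlyClose' h h' hε1 hlo hhi) φ

/-- **`ℰ_{h'}(Σ) ≤ (1+ε)^{3/2} (1−ε)⁻¹ ℰ_h(Σ)` for uniformly close metrics** (`(1 − ε) h ≤ h' ≤
(1 + ε) h` pointwise, `0 ≤ ε < 1`), for the capacity of Def. 17 of any horizon. Bray 2001, §6: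
"change the metric uniformly pointwise as small as one likes … `ℰ` changes as small as one likes
as well". [cite: BrayRPI2001, §6 paragraph after Def. 16; proof of Thm. 9 before (94)] -/
theorem horizonCapacity_le_mul_of_uniformlyClose (e : AFEnd X) (U : Opens X) {ε : ℝ}
    (hε0 : 0 ≤ ε) (hε1 : ε < 1)
    (hlo : ∀ (x : X) (v : TangentSpace (𝓡 3) x),
      (1 - ε) * (ofRiemannian h).val x v v ≤ (ofRiemannian h').val x v v)
    (hhi : ∀ (x : X) (v : TangentSpace (𝓡 3) x),
      (ofRiemannian h').val x v v ≤ (1 + ε) * (ofRiemannian h).val x v v) :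
    horizonCapacity h' e U ≤
      ENNReal.ofReal (Real.sqrt ((1 + ε) ^ 3) * (1 - ε)⁻¹) * horizonCapacity h e U := by
  have h1ε : 0 < 1 - ε := by linarith
  have hK : 0 < Real.sqrt ((1 + ε) ^ 3) * (1 - ε)⁻¹ :=
    mul_pos (Real.sqrt_pos.2 (by positivity)) (inv_pos.2 h1ε)
  exact horizonCapacity_le_mul_of_forall_dirichletEnergy_le h h' e U (ENNReal.ofReal_pos.2 hK).ne'
    ENNReal.ofReal_ne_top fun φ _ ↦ dirichletEnergy_le_mul_of_uniformlyClose h h' hε0 hε1 hlo hhi φ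

/-- **`ℰ_h(Σ) ≤ (1+ε) (1−ε)^{−3/2} ℰ_{h'}(Σ)` for uniformly close metrics** (`(1 − ε) h ≤ h' ≤
(1 + ε) h` pointwise, `0 ≤ ε < 1`). With `horizonCapacity_le_mul_of_uniformlyClose` this pins
`ℰ_{h'}(Σ)` between `(1+ε)⁻¹ (1−ε)^{3/2} ℰ_h(Σ)` and `(1+ε)^{3/2} (1−ε)⁻¹ ℰ_h(Σ)`.
[cite: BrayRPI2001, §6 paragraph after Def. 16; proof of Thm. 9 before (94)] -/
theorem horizonCapacity_le_mul_of_uniformlyClose' (e : AFEnd X) (U : Opens X) {ε : ℝ}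
    (hε0 : 0 ≤ ε) (hε1 : ε < 1)
    (hlo : ∀ (x : X) (v : TangentSpace (𝓡 3) x),
      (1 - ε) * (ofRiemannian h).val x v v ≤ (ofRiemannian h').val x v v)
    (hhi : ∀ (x : X) (v : TangentSpace (𝓡 3) x),
      (ofRiemannian h').val x v v ≤ (1 + ε) * (ofRiemannian h).val x v v) :
    horizonCapacity h e U ≤
      ENNReal.ofReal (Real.sqrt (((1 - ε) ^ 3)⁻¹) * (1 + ε)) * horizonCapacity h' e U := by
  have h1ε : 0 < 1 - ε := by linarith
  have hK : 0 < Real.sqrt (((1 - ε) ^ 3)⁻¹) * (1 + ε) :=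
    mul_pos (Real.sqrt_pos.2 (inv_pos.2 (pow_pos h1ε 3))) (by linarith)
  exact horizonCapacity_le_mul_of_forall_dirichletEnergy_le h' h e U (ENNReal.ofReal_pos.2 hK).ne'
    ENNReal.ofReal_ne_top fun φ _ ↦ dirichletEnergy_le_mul_of_uniformlyClose' h h' hε0 hε1 hlo hhi φ

end EnergyComparison

/-! ### Continuity of energies and capacities under uniformly close metrics -/

section Limits

/-- The comparison constant `(1+ε)^{3/2} (1−ε)⁻¹` tends to `1` as `ε → 0`. [folklore] -/
theorem tendsto_sqrt_cube_mul_inv :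
    Tendsto (fun ε : ℝ ↦ Real.sqrt ((1 + ε) ^ 3) * (1 - ε)⁻¹) (𝓝 0) (𝓝 1) := by
  have h1 : Tendsto (fun ε : ℝ ↦ Real.sqrt ((1 + ε) ^ 3)) (𝓝 0) (𝓝 1) := by
    have h : ContinuousAt (fun ε : ℝ ↦ Real.sqrt ((1 + ε) ^ 3)) 0 :=
      ((continuousAt_const.add continuousAt_id).pow 3).sqrt
    simpa using h.tendsto
  have h2 : Tendsto (fun ε : ℝ ↦ (1 - ε)⁻¹) (𝓝 0) (𝓝 1) := by
    have h : Tendsto (fun ε : ℝ ↦ 1 - ε) (𝓝 0) (𝓝 1) := by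
      simpa using (tendsto_const_nhds (x := (1 : ℝ))).sub (Filter.tendsto_id (x := 𝓝 (0 : ℝ)))
    simpa using h.inv₀ one_ne_zero
  simpa using h1.mul h2

/-- The comparison constant `(1−ε)^{−3/2} (1+ε)` tends to `1` as `ε → 0`. [folklore] -/
theorem tendsto_sqrt_inv_cube_mul :
    Tendsto (fun ε : ℝ ↦ Real.sqrt (((1 - ε) ^ 3)⁻¹) * (1 + ε)) (𝓝 0) (𝓝 1) := by
  have h1 : Tendsto (fun ε : ℝ ↦ Real.sqrt (((1 - ε) ^ 3)⁻¹)) (𝓝 0) (𝓝 1) := by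
    have h : Tendsto (fun ε : ℝ ↦ ((1 - ε) ^ 3)⁻¹) (𝓝 0) (𝓝 1) := by
      have h' : Tendsto (fun ε : ℝ ↦ (1 - ε) ^ 3) (𝓝 0) (𝓝 1) := by
        simpa using ((tendsto_const_nhds (x := (1 : ℝ))).sub
          (Filter.tendsto_id (x := 𝓝 (0 : ℝ)))).pow 3
      simpa using h'.inv₀ one_ne_zero
    simpa using h.sqrt
  have h2 : Tendsto (fun ε : ℝ ↦ 1 + ε) (𝓝 0) (𝓝 1) := by
    simpa using (tendsto_const_nhds (x := (1 : ℝ))).add (Filter.tendsto_id (x := 𝓝 (0 : ℝ)))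
  simpa using h1.mul h2

/-- **Squeeze in `ℝ≥0∞` with multiplicative constants tending to one.** If for all small `ε > 0`,
eventually along `l`, `F n ≤ K(ε) A` and `A ≤ K'(ε) F n`, where `K(ε), K'(ε) → 1` as `ε → 0⁺`,
then `F n → A` (also when `A = ∞`). [folklore] -/
theorem ENNReal.tendsto_of_forall_eventually_le_mul {ι : Type*} {l : Filter ι} {F : ι → ℝ≥0∞}
    {A : ℝ≥0∞} {K K' : ℝ → ℝ} (hK : Tendsto K (𝓝[>] 0) (𝓝 1)) (hK' : Tendsto K' (𝓝[>] 0) (𝓝 1))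
    (hup : ∀ᶠ ε in 𝓝[>] (0 : ℝ), ∀ᶠ n in l, F n ≤ ENNReal.ofReal (K ε) * A)
    (hlow : ∀ᶠ ε in 𝓝[>] (0 : ℝ), ∀ᶠ n in l, A ≤ ENNReal.ofReal (K' ε) * F n) :
    Tendsto F l (𝓝 A) := by
  rw [tendsto_order]
  constructor
  · -- lower semicontinuity side: `a < A ⇒` eventually `a < F n`
    intro a ha
    have hT : Tendsto (fun ε ↦ ENNReal.ofReal (K' ε)⁻¹ * A) (𝓝[>] 0) (𝓝 A) := by
      have h1 : Tendsto (fun ε ↦ (K' ε)⁻¹) (𝓝[>] 0) (𝓝 1) := by simpa using hK'.inv₀ one_ne_zero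
      have h2 := ENNReal.Tendsto.mul_const (b := A) (ENNReal.tendsto_ofReal h1) (Or.inl (by simp))
      simpa using h2
    have hpos : ∀ᶠ ε in 𝓝[>] (0 : ℝ), 0 < K' ε :=
      (hK'.eventually_const_lt one_half_lt_one).mono fun ε hε ↦ by linarith
    obtain ⟨ε, hε, hKε, hlt⟩ := (hlow.and (hpos.and (hT.eventually_const_lt ha))).exists
    filter_upwards [hε] with n hn
    refine hlt.trans_le ?_
    calc ENNReal.ofReal (K' ε)⁻¹ * A ≤ ENNReal.ofReal (K' ε)⁻¹ * (ENNReal.ofReal (K' ε) * F n) :=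
          mul_le_mul_right hn _
      _ = F n := by
          rw [← mul_assoc, ← ENNReal.ofReal_mul (inv_nonneg.2 hKε.le), inv_mul_cancel₀ hKε.ne',
            ENNReal.ofReal_one, one_mul]
  · -- upper semicontinuity side: `A < b ⇒` eventually `F n < b`
    intro b hb
    have hT : Tendsto (fun ε ↦ ENNReal.ofReal (K ε) * A) (𝓝[>] 0) (𝓝 A) := by
      have h2 := ENNReal.Tendsto.mul_const (b := A) (ENNReal.tendsto_ofReal hK) (Or.inl (by simp))
      simpa using h2
    obtain ⟨ε, hε, hlt⟩ := (hup.and (hT.eventually_lt_const hb)).exists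
    filter_upwards [hε] with n hn
    exact hn.trans_lt hlt

variable {X : Type} [TopologicalSpace X] [ChartedSpace E3 X] [IsManifold (𝓡 3) ∞ X]
  [T2Space X] [LocallyCompactSpace X] [MeasurableSpace X] [BorelSpace X] [SecondCountableTopology X]
  (h : ContMDiffRiemannianMetric (𝓡 3) ∞ E3 (TangentSpace (𝓡 3) : X → Type _))
  {ι : Type*} {l : Filter ι}
  (hs : ι → ContMDiffRiemannianMetric (𝓡 3) ∞ E3 (TangentSpace (𝓡 3) : X → Type _))

/-- **Dirichlet energies converge under uniformly close metrics**: if for every `ε > 0`,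
eventually `(1 − ε) h ≤ h_n ≤ (1 + ε) h` pointwise, then `∫ |∇φ|²_{h_n} dV_{h_n} → ∫ |∇φ|²_h dV_h`
for every `φ : X → ℝ` (in `ℝ≥0∞`). Bray 2001, §6: metrics "arbitrarily uniformly close to each
other" have close energies. [cite: BrayRPI2001, §6 paragraph after Def. 16; proof of Thm. 9
before (94)] -/
theorem tendsto_dirichletEnergy_of_uniformlyClose
    (hclose : ∀ ε : ℝ, 0 < ε → ∀ᶠ n in l, ∀ (x : X) (v : TangentSpace (𝓡 3) x),
      (1 - ε) * (ofRiemannian h).val x v v ≤ (ofRiemannian (hs n)).val x v v ∧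
        (ofRiemannian (hs n)).val x v v ≤ (1 + ε) * (ofRiemannian h).val x v v)
    (φ : X → ℝ) :
    Tendsto (fun n ↦ dirichletEnergy (hs n) φ) l (𝓝 (dirichletEnergy h φ)) := by
  have hI : ∀ᶠ ε in 𝓝[>] (0 : ℝ), 0 < ε ∧ ε < 1 := Ioo_mem_nhdsGT one_pos
  refine ENNReal.tendsto_of_forall_eventually_le_mul
    (tendsto_nhdsWithin_of_tendsto_nhds tendsto_sqrt_cube_mul_inv)
    (tendsto_nhdsWithin_of_tendsto_nhds tendsto_sqrt_inv_cube_mul)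
    (hI.mono fun ε hε ↦ ?_) (hI.mono fun ε hε ↦ ?_)
  · filter_upwards [hclose ε hε.1] with n hn
    exact dirichletEnergy_le_mul_of_uniformlyClose h (hs n) hε.1.le hε.2 (fun x v ↦ (hn x v).1)
      (fun x v ↦ (hn x v).2) φ
  · filter_upwards [hclose ε hε.1] with n hn
    exact dirichletEnergy_le_mul_of_uniformlyClose' h (hs n) hε.1.le hε.2 (fun x v ↦ (hn x v).1)
      (fun x v ↦ (hn x v).2) φ

/-- **The capacity `ℰ(Σ, g)` is continuous in the metric for uniform pointwise convergence**: if
for every `ε > 0`, eventually `(1 − ε) h ≤ h_n ≤ (1 + ε) h` pointwise on `X`, then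
`ℰ_{h_n}(Σ) → ℰ_h(Σ)` in `ℝ≥0∞` (`horizonCapacity (hs n) e U → horizonCapacity h e U`). This is the
step *"since such a modification can be done so as to change the metric uniformly pointwise as
small as one likes, it follows that `ℰ` changes as small as one likes as well"* of Bray 2001, §6
(after Def. 16), used again in the proof of Thm. 9 ("the metrics are arbitrarily uniformly close
to each other … it follows that `ℰ(g̃_δ)` is close to `ℰ(ḡ)`", before (94)), here for the
capacity of Def. 17 on a fixed manifold. [cite: BrayRPI2001, §6 paragraph after Def. 16 and
proof of Thm. 9 before (94)] -/
theorem tendsto_horizonCapacity_of_uniformlyClose (e : AFEnd X) (U : Opens X)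
    (hclose : ∀ ε : ℝ, 0 < ε → ∀ᶠ n in l, ∀ (x : X) (v : TangentSpace (𝓡 3) x),
      (1 - ε) * (ofRiemannian h).val x v v ≤ (ofRiemannian (hs n)).val x v v ∧
        (ofRiemannian (hs n)).val x v v ≤ (1 + ε) * (ofRiemannian h).val x v v) :
    Tendsto (fun n ↦ horizonCapacity (hs n) e U) l (𝓝 (horizonCapacity h e U)) := by
  have hI : ∀ᶠ ε in 𝓝[>] (0 : ℝ), 0 < ε ∧ ε < 1 := Ioo_mem_nhdsGT one_pos
  refine ENNReal.tendsto_of_forall_eventually_le_mul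
    (tendsto_nhdsWithin_of_tendsto_nhds tendsto_sqrt_cube_mul_inv)
    (tendsto_nhdsWithin_of_tendsto_nhds tendsto_sqrt_inv_cube_mul)
    (hI.mono fun ε hε ↦ ?_) (hI.mono fun ε hε ↦ ?_)
  · filter_upwards [hclose ε hε.1] with n hn
    exact horizonCapacity_le_mul_of_uniformlyClose h (hs n) e U hε.1.le hε.2 (fun x v ↦ (hn x v).1)
      fun x v ↦ (hn x v).2
  · filter_upwards [hclose ε hε.1] with n hn
    exact horizonCapacity_le_mul_of_uniformlyClose' h (hs n) e U hε.1.le hε.2 (fun x v ↦ (hn x v).1)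
      fun x v ↦ (hn x v).2

/-- **`ℰ_{h_n}(Σ) → ℰ_h(Σ)` in `ℝ`** under uniformly close metrics, when `ℰ_h(Σ)` is finite (as it
is for the outside of a horizon, `horizonCapacity_lt_top` of `MassCapacityProofs.lean`): the form
in which the capacity enters `Bray2001_mass_ge_half_capacity` (`(horizonCapacity …).toReal`).
[cite: BrayRPI2001, §6 paragraph after Def. 16 and proof of Thm. 9 before (94)] -/
theorem tendsto_horizonCapacity_toReal_of_uniformlyClose (e : AFEnd X) (U : Opens X)
    (hfin : horizonCapacity h e U ≠ ⊤)
    (hclose : ∀ ε : ℝ, 0 < ε → ∀ᶠ n in l, ∀ (x : X) (v : TangentSpace (𝓡 3) x),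
      (1 - ε) * (ofRiemannian h).val x v v ≤ (ofRiemannian (hs n)).val x v v ∧
        (ofRiemannian (hs n)).val x v v ≤ (1 + ε) * (ofRiemannian h).val x v v) :
    Tendsto (fun n ↦ (horizonCapacity (hs n) e U).toReal) l (𝓝 (horizonCapacity h e U).toReal) :=
  (ENNReal.tendsto_toReal hfin).comp (tendsto_horizonCapacity_of_uniformlyClose h hs e U hclose)

end Limits

/-! ### The conformal case `g' = u⁴ h` (Bray 2001, (102)–(103)) -/

section Conformal

variable {X : Type} [TopologicalSpace X] [ChartedSpace E3 X] [IsManifold (𝓡 3) ∞ X]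
  [T2Space X] [LocallyCompactSpace X] [MeasurableSpace X] [BorelSpace X] [SecondCountableTopology X]
  (D : InitialDataSet (𝓡 3) X)

omit [T2Space X] [LocallyCompactSpace X] [MeasurableSpace X] [BorelSpace X]
  [SecondCountableTopology X] in
/-- The metric of a data set is nonnegative on the diagonal: `h_x(v, v) ≥ 0`. [folklore] -/
theorem InitialDataSet.metric_val_self_nonneg (x : X) (v : TangentSpace (𝓡 3) x) :
    0 ≤ D.metric.val x v v := by
  by_cases hv : v = 0
  · subst hv; simp
  · exact (D.isRiemannian_metric x v hv).le

omit [T2Space X] [LocallyCompactSpace X] [MeasurableSpace X] [BorelSpace X]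
  [SecondCountableTopology X] in
/-- A conformal factor with `1 − ε ≤ u⁴ ≤ 1 + ε` makes `u⁴ h` uniformly `ε`-close to `h`:
`(1 − ε) h(v,v) ≤ (u⁴h)(v,v) ≤ (1 + ε) h(v,v)`. Bray 2001, (102)–(103). [cite: BrayRPI2001,
§6 (102)–(103)] -/
theorem InitialDataSet.conformal_uniformlyClose {u : X → ℝ} (hu : ContMDiff (𝓡 3) 𝓘(ℝ) ∞ u)
    (hpos : ∀ x, 0 < u x) {ε : ℝ} (hlo : ∀ x, 1 - ε ≤ u x ^ 4) (hhi : ∀ x, u x ^ 4 ≤ 1 + ε)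
    (x : X) (v : TangentSpace (𝓡 3) x) :
    (1 - ε) * (ofRiemannian D.h).val x v v ≤ (ofRiemannian (D.conformal u hu hpos).h).val x v v ∧
      (ofRiemannian (D.conformal u hu hpos).h).val x v v ≤ (1 + ε) * (ofRiemannian D.h).val x v v := by
  have hval : (ofRiemannian (D.conformal u hu hpos).h).val x v v = u x ^ 4 * (ofRiemannian D.h).val x v v :=
    D.metric_conformal_val u hu hpos x v v
  have h0 : 0 ≤ (ofRiemannian D.h).val x v v := D.metric_val_self_nonneg x v
  rw [hval]
  exact ⟨mul_le_mul_of_nonneg_right (hlo x) h0, mul_le_mul_of_nonneg_right (hhi x) h0⟩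

/-- **`ℰ_{u⁴h}(Σ) ≤ (1+ε)^{3/2} (1−ε)⁻¹ ℰ_h(Σ)` for a conformal factor with `1 − ε ≤ u⁴ ≤ 1 + ε`**
(`0 ≤ ε < 1`). Bray 2001, proof of Thm. 9: `g̃_δ = u_δ⁴ ḡ_δ` with `1 ≤ u_δ ≤ 1 + ε(δ)`, (102)–(103),
"hence … the same statement is true for `g̃_δ`". [cite: BrayRPI2001, §6 (102)–(103)] -/
theorem horizonCapacity_conformal_le_mul (e : AFEnd X) (U : Opens X) {u : X → ℝ}
    (hu : ContMDiff (𝓡 3) 𝓘(ℝ) ∞ u) (hpos : ∀ x, 0 < u x) {ε : ℝ} (hε0 : 0 ≤ ε) (hε1 : ε < 1)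
    (hlo : ∀ x, 1 - ε ≤ u x ^ 4) (hhi : ∀ x, u x ^ 4 ≤ 1 + ε) :
    horizonCapacity (D.conformal u hu hpos).h e U ≤
      ENNReal.ofReal (Real.sqrt ((1 + ε) ^ 3) * (1 - ε)⁻¹) * horizonCapacity D.h e U :=
  horizonCapacity_le_mul_of_uniformlyClose D.h (D.conformal u hu hpos).h e U hε0 hε1
    (fun x v ↦ (D.conformal_uniformlyClose hu hpos hlo hhi x v).1)
    fun x v ↦ (D.conformal_uniformlyClose hu hpos hlo hhi x v).2

/-- **`ℰ_h(Σ) ≤ (1+ε) (1−ε)^{−3/2} ℰ_{u⁴h}(Σ)` for a conformal factor with `1 − ε ≤ u⁴ ≤ 1 + ε`**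
(`0 ≤ ε < 1`). Bray 2001, proof of Thm. 9, (102)–(103). [cite: BrayRPI2001, §6 (102)–(103)] -/
theorem horizonCapacity_le_mul_conformal (e : AFEnd X) (U : Opens X) {u : X → ℝ}
    (hu : ContMDiff (𝓡 3) 𝓘(ℝ) ∞ u) (hpos : ∀ x, 0 < u x) {ε : ℝ} (hε0 : 0 ≤ ε) (hε1 : ε < 1)
    (hlo : ∀ x, 1 - ε ≤ u x ^ 4) (hhi : ∀ x, u x ^ 4 ≤ 1 + ε) :
    horizonCapacity D.h e U ≤
      ENNReal.ofReal (Real.sqrt (((1 - ε) ^ 3)⁻¹) * (1 + ε)) *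
        horizonCapacity (D.conformal u hu hpos).h e U :=
  horizonCapacity_le_mul_of_uniformlyClose' D.h (D.conformal u hu hpos).h e U hε0 hε1
    (fun x v ↦ (D.conformal_uniformlyClose hu hpos hlo hhi x v).1)
    fun x v ↦ (D.conformal_uniformlyClose hu hpos hlo hhi x v).2

/-- **`ℰ_{u_n⁴ h}(Σ) → ℰ_h(Σ)` when the conformal factors `u_n → 1` uniformly on `X`** (in
`ℝ≥0∞`). Bray 2001, proof of Thm. 9: "since `lim_{δ→0} u_δ(x) = 1` with the uniform bound (103) …
the horizon energies converge" (the conformal-factor part of the convergence `ℰ(g̃_δ) → ℰ(ḡ)`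
after (104)). [cite: BrayRPI2001, §6 (102)–(104)] -/
theorem tendsto_horizonCapacity_conformal (e : AFEnd X) (U : Opens X) {ι : Type*} {l : Filter ι}
    {u : ι → X → ℝ} (hu : ∀ n, ContMDiff (𝓡 3) 𝓘(ℝ) ∞ (u n)) (hpos : ∀ n x, 0 < u n x)
    (hlim : TendstoUniformly u (fun _ ↦ (1 : ℝ)) l) :
    Tendsto (fun n ↦ horizonCapacity (D.conformal (u n) (hu n) (hpos n)).h e U) l
      (𝓝 (horizonCapacity D.h e U)) := by
  refine tendsto_horizonCapacity_of_uniformlyClose D.h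
    (fun n ↦ (D.conformal (u n) (hu n) (hpos n)).h) e U fun ε hε ↦ ?_
  -- `t ↦ t⁴` is continuous at `1`: `|t - 1| < δ ⇒ |t⁴ - 1| < ε`
  obtain ⟨δ, hδ, hδε⟩ := Metric.continuousAt_iff.1 ((continuous_pow 4).continuousAt (x := (1 : ℝ))) ε hε
  filter_upwards [Metric.tendstoUniformly_iff.1 hlim δ hδ] with n hn x v
  have h4 : |u n x ^ 4 - 1| < ε := by
    have h := hδε (x := u n x) (by simpa [dist_comm] using hn x)
    simpa [Real.dist_eq] using h
  have hlo : ∀ y, |u n y ^ 4 - 1| < ε → 1 - ε ≤ u n y ^ 4 := fun y hy ↦ by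
    linarith [(abs_sub_lt_iff.1 hy).2]
  have hhi : ∀ y, |u n y ^ 4 - 1| < ε → u n y ^ 4 ≤ 1 + ε := fun y hy ↦ by
    linarith [(abs_sub_lt_iff.1 hy).1]
  have hall : ∀ y, |u n y ^ 4 - 1| < ε := fun y ↦ by
    have h := hδε (x := u n y) (by simpa [dist_comm] using hn y)
    simpa [Real.dist_eq] using h
  exact D.conformal_uniformlyClose (hu n) (hpos n) (fun y ↦ hlo y (hall y)) (fun y ↦ hhi y (hall y)) x v

end Conformal

end Literature.Geometry.Lorentzian

end
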